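import Summits.MatrixMultiplication.MatrixMultiplication.Theorems.CharacteristicContinuityEventualTransfer
import HarnessLib

/-!
# CharacteristicContinuityTransferHorizon — how far the finite range must reach on the characteristic axis
(decomp-mm cell, lens 5 «finite/base range + asymptotic regime + bridge», generation 10)

Helper for the residual items of `route-MatrixMultiplication-CharacteristicContinuity`
(`EventualTransfer` = K′, item 30790; `ContinuityAtZero` = K, item 18039).

A TRANSFER HORIZON is any function `B : ℕ → ℕ` such that complex rank upper bounds at format `n` are
decided by every characteristic `p ≥ B n`:
`R_{𝔽̄_p}(⟨n,n,n⟩) ≤ r → R_ℂ(⟨n,n,n⟩) ≤ r` whenever `p ≥ B n` (`IsTransferHorizon B`, written out below).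
Horizons exist (`exists_transferHorizon`, from `fixedFormatContinuity_holds` — non-effective); the
arithmetic Nullstellensatz makes one explicit, doubly exponential in `n²`
([cite: KrickPardoSombra2001, Thm 1], arXiv:math/9911094 p. 2: if the Brent equations of format `n` and
rank `r` — `N = 3rn²` unknowns, `s = n⁶` equations, degree `d = 3`, height `h = 0` — have no complex
solution, then `a = Σ gᵢ fᵢ` with `a ∈ ℤ ∖ {0}`, `gᵢ ∈ ℤ[x]` and
`log |a| ≤ 4N(N+1)·3^N·(6 log n + 3(N+7) log (N+1))`; reducing mod `p` shows that no `𝔽̄_p`-solution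
exists once `p > |a|`, so `B n := max_{r ≤ n³} exp(4N(N+1)3^N(6 log n + 3(N+7) log(N+1)))` is a horizon).

* `eventualTransfer_iff_witness_below_horizon`: for EVERY transfer horizon `B`,
  K′ ↔ for every `ε > 0` and infinitely many primes `p` there is a near-optimal witness
  `R_{𝔽̄_p}(⟨n,n,n⟩) ≤ n^{ω_p+ε}` at a format `n ≥ 2` BELOW THE HORIZON, `B n ≤ p`.
  With the explicit horizon (`log B n ≈ 3^{3rn²}`, `r ≤ n³`) this reads: the finite range must reach
  formats `n` of order `(log log p)^{1/5}` for infinitely many `p` — the quantitative form of «how far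
  the base range must reach for the bridge (fixed-format Lefschetz transfer) to bite on ω».
* `continuityAtZero_iff_witness_below_horizon`: the same with «all large `p`» for K.

References: [cite: BurgisserClausenShokrollahi1997, Cor. (15.18)]; [cite: Blaser2013, Def. 5.1];
[cite: KrickPardoSombra2001, Thm 1].
-/

set_option linter.dupNamespace false -- `MatrixMultiplication.MatrixMultiplication` (summit = problem, D-0017)

noncomputable section

open Filter Finset
open Literature.Computability.AlgebraicComplexity
open Summit.MatrixMultiplication.MatrixMultiplication.Theses.CharacteristicContinuity
open Summit.MatrixMultiplication.MatrixMultiplication.Theorems.CharacteristicContinuityTransfer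
open Summit.MatrixMultiplication.MatrixMultiplication.Theorems.CharacteristicContinuityFixedFormat
open Summit.MatrixMultiplication.MatrixMultiplication.Theorems.CharacteristicContinuityEventualTransfer
open Summit.MatrixMultiplication.MatrixMultiplication.Theorems.CharacteristicContinuityUniformWitness

namespace Summit.MatrixMultiplication.MatrixMultiplication.Theorems.CharacteristicContinuityTransferHorizon

/-- A (non-effective) transfer horizon exists: beyond `B n`, `𝔽̄_p`-rank bounds at format `n` are complex
rank bounds (`fixedFormatContinuity_holds`). [cite: BurgisserClausenShokrollahi1997, Cor. (15.18)] -/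
theorem exists_transferHorizon :
    ∃ B : ℕ → ℕ, ∀ (n r p : ℕ) [Fact p.Prime], B n ≤ p →
      tensorRank (matMulTensor (AlgebraicClosure (ZMod p)) n n n) ≤ r →
        tensorRank (matMulTensor ℂ n n n) ≤ r := by
  have h : ∀ n : ℕ, ∃ p₀ : ℕ, ∀ (p : ℕ) [Fact p.Prime], p₀ ≤ p →
      tensorRank (matMulTensor (AlgebraicClosure (ZMod p)) n n n) =
        tensorRank (matMulTensor ℂ n n n) := fun n => fixedFormatContinuity_holds n n n
  choose B hB using h
  exact ⟨B, fun n r p inst hp hr => (hB n p hp) ▸ hr⟩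

/-- **K′ below a horizon.** For every transfer horizon `B`: eventual transfer (item 30790) holds iff for
every `ε > 0`, for infinitely many primes `p`, a near-optimal witness of format `n ≥ 2` with `B n ≤ p`
exists. [cite: BurgisserClausenShokrollahi1997, Cor. (15.18)] [cite: Blaser2013, Def. 5.1] -/
theorem eventualTransfer_iff_witness_below_horizon (B : ℕ → ℕ)
    (hB : ∀ (n r p : ℕ) [Fact p.Prime], B n ≤ p →
      tensorRank (matMulTensor (AlgebraicClosure (ZMod p)) n n n) ≤ r →
        tensorRank (matMulTensor ℂ n n n) ≤ r) :
    (∀ β : ℝ, (∃ p₀ : ℕ, ∀ (p : ℕ) [Fact p.Prime], p₀ ≤ p → omega (AlgebraicClosure (ZMod p)) ≤ β) →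
        omega ℂ ≤ β) ↔
      (∀ ε : ℝ, 0 < ε → ∀ p₀ : ℕ, ∃ (p : ℕ) (_ : Fact p.Prime), p₀ ≤ p ∧ ∃ n : ℕ, 2 ≤ n ∧ B n ≤ p ∧
        (tensorRank (matMulTensor (AlgebraicClosure (ZMod p)) n n n) : ℝ) ≤
          (n : ℝ) ^ (omega (AlgebraicClosure (ZMod p)) + ε)) := by
  constructor
  · -- from the bounded-format criterion: a fixed format `n ≤ N` recurs; wait until `p ≥ max_{n ≤ N} B n`
    intro hK' ε hε p₀
    obtain ⟨N, hN⟩ := (eventualTransfer_iff_uniformWitnessIO.1 hK') ε hε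
    obtain ⟨p, inst, hp, n, hn2, hnN, hrank⟩ := hN (max p₀ ((Finset.range (N + 1)).sup B))
    refine ⟨p, inst, (le_max_left _ _).trans hp, n, hn2, ?_, hrank⟩
    exact (Finset.le_sup (f := B) (Finset.mem_range.2 (Nat.lt_succ_of_le hnN))).trans
      ((le_max_right _ _).trans hp)
  · -- a witness below the horizon transfers its rank bound to `ℂ`
    rintro hW β ⟨p₀, hβ⟩
    refine le_of_forall_pos_le_add fun δ hδ => ?_
    obtain ⟨p, inst, hp, n, hn2, hBn, hrank⟩ := hW δ hδ p₀
    set r := tensorRank (matMulTensor (AlgebraicClosure (ZMod p)) n n n) with hr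
    have hC : tensorRank (matMulTensor ℂ n n n) ≤ r := hB n r p hBn le_rfl
    have hωp := @hβ p inst hp
    have hn1 : (1 : ℝ) ≤ n := by exact_mod_cast (le_trans one_le_two hn2)
    have hC' : (tensorRank (matMulTensor ℂ n n n) : ℝ) ≤ (n : ℝ) ^ (β + δ) := by
      calc (tensorRank (matMulTensor ℂ n n n) : ℝ) ≤ r := by exact_mod_cast hC
        _ ≤ (n : ℝ) ^ (omega (AlgebraicClosure (ZMod p)) + δ) := hrank
        _ ≤ (n : ℝ) ^ (β + δ) := Real.rpow_le_rpow_of_exponent_le hn1 (by linarith)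
    exact omega_le_of_tensorRank_le_rpow ℂ hn2 hC'

/-- **K below a horizon.** For every transfer horizon `B`: `ContinuityAtZero` (item 18039) holds iff for
every `ε > 0` and ALL large primes `p` a near-optimal witness of format `n ≥ 2` with `B n ≤ p` exists.
[cite: BurgisserClausenShokrollahi1997, Cor. (15.18)] [cite: Blaser2013, Def. 5.1] -/
theorem continuityAtZero_iff_witness_below_horizon (B : ℕ → ℕ)
    (hB : ∀ (n r p : ℕ) [Fact p.Prime], B n ≤ p →
      tensorRank (matMulTensor (AlgebraicClosure (ZMod p)) n n n) ≤ r →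
        tensorRank (matMulTensor ℂ n n n) ≤ r) :
    ContinuityAtZero ↔
      (∀ ε : ℝ, 0 < ε → ∃ p₀ : ℕ, ∀ (p : ℕ) [Fact p.Prime], p₀ ≤ p → ∃ n : ℕ, 2 ≤ n ∧ B n ≤ p ∧
        (tensorRank (matMulTensor (AlgebraicClosure (ZMod p)) n n n) : ℝ) ≤
          (n : ℝ) ^ (omega (AlgebraicClosure (ZMod p)) + ε)) := by
  constructor
  · intro hK ε hε
    obtain ⟨N, p₁, hNp⟩ := (uniformWitnessIff_holds.1 hK) ε hε
    refine ⟨max p₁ ((Finset.range (N + 1)).sup B), fun p inst hp => ?_⟩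
    obtain ⟨n, hn2, hnN, hrank⟩ := @hNp p inst ((le_max_left _ _).trans hp)
    refine ⟨n, hn2, ?_, hrank⟩
    exact (Finset.le_sup (f := B) (Finset.mem_range.2 (Nat.lt_succ_of_le hnN))).trans
      ((le_max_right _ _).trans hp)
  · intro hW ε hε
    obtain ⟨p₀, hp₀⟩ := hW ε hε
    refine ⟨p₀, fun p inst hp => ?_⟩
    obtain ⟨n, hn2, hBn, hrank⟩ := @hp₀ p inst hp
    set r := tensorRank (matMulTensor (AlgebraicClosure (ZMod p)) n n n) with hr
    have hC : tensorRank (matMulTensor ℂ n n n) ≤ r := hB n r p hBn le_rfl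
    refine omega_le_of_tensorRank_le_rpow ℂ hn2 ?_
    calc (tensorRank (matMulTensor ℂ n n n) : ℝ) ≤ r := by exact_mod_cast hC
      _ ≤ (n : ℝ) ^ (omega (AlgebraicClosure (ZMod p)) + ε) := hrank

end Summit.MatrixMultiplication.MatrixMultiplication.Theorems.CharacteristicContinuityTransferHorizon

end
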